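import Mathlib
import Summits.NavierStokesRegularity.TurbBounds.SpectralFormFreeSlip

/-!
# FS-U1″ mode lemma — Calculus (`TurbBounds/FSU1/Mode/M01Calculus.lean`)

Shared one-variable calculus: regularity of `V ∈ C³` and `Ω = vort k V`, hyperbolic/exponential derivatives, Green's identity, integration by parts for `a(φ,Ω)`, discriminant Cauchy–Schwarz (plain and weighted).

Cell-made mathematics of FS-PROOF-DRAFT §3 (pub-turb-sos), kernel-checked; generated from the design compose file
`StageF_compose.check.lean` (96c4b9bf…) by `build_mode_split.py`.  HONEST FRAMING: rigorous bounds for the stated PDE and boundary conditions; no claim about physical turbulence beyond the bound.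
-/

open Real intervalIntegral MeasureTheory Set

namespace Summit.NavierStokesRegularity.TurbBounds.FSU1.Mode

open Summit.NavierStokesRegularity.TurbBounds.SpectralFormFreeSlip

/-- `V ∈ C³ ⇒ V′ ∈ C²`. -/
theorem contDiff_two_deriv {v : ℝ → ℝ} (hv : ContDiff ℝ 3 v) : ContDiff ℝ 2 (deriv v) := by
  have h3 : ContDiff ℝ ((2 : WithTop ℕ∞) + 1) v := by
    have e : ((2 : WithTop ℕ∞) + 1) = 3 := by norm_num
    rw [e]; exact hv
  exact (contDiff_succ_iff_deriv.1 h3).2.2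

/-- `V ∈ C³ ⇒ V″ ∈ C¹`. -/
theorem contDiff_one_deriv_deriv {v : ℝ → ℝ} (hv : ContDiff ℝ 3 v) : ContDiff ℝ 1 (deriv (deriv v)) := by
  have h2 : ContDiff ℝ ((1 : WithTop ℕ∞) + 1) (deriv v) := by
    simpa [one_add_one_eq_two] using contDiff_two_deriv hv
  exact (contDiff_succ_iff_deriv.1 h2).2.2

/-- `V ∈ C³ ⇒ Ω = vort k V ∈ C¹`. -/
theorem contDiff_one_vort {v : ℝ → ℝ} (hv : ContDiff ℝ 3 v) (k : ℝ) : ContDiff ℝ 1 (vort k v) := by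
  have h : ContDiff ℝ 1 (fun z => (deriv (deriv v) z - k ^ 2 * v z) / k) :=
    ((contDiff_one_deriv_deriv hv).sub (contDiff_const.mul (hv.of_le (by norm_num)))).div_const k
  exact h

/-- `V ∈ C³ ⇒ vort k V` is continuous. -/
theorem continuous_vort {v : ℝ → ℝ} (hv : ContDiff ℝ 3 v) (k : ℝ) : Continuous (vort k v) :=
  (contDiff_one_vort hv k).continuous

/-- `V ∈ C³ ⇒ (vort k V)′` is continuous. -/
theorem continuous_deriv_vort {v : ℝ → ℝ} (hv : ContDiff ℝ 3 v) (k : ℝ) : Continuous (deriv (vort k v)) :=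
  (contDiff_one_vort hv k).continuous_deriv le_rfl

/-- `θ ∈ C¹ ⇒ θ′` is continuous. -/
theorem continuous_deriv_of_contDiff_one {θ : ℝ → ℝ} (hθ : ContDiff ℝ 1 θ) : Continuous (deriv θ) :=
  hθ.continuous_deriv le_rfl

/-- Regularity package for `v ∈ C³`. -/
theorem diff_pack {v : ℝ → ℝ} (hv : ContDiff ℝ 3 v) :
    Differentiable ℝ v ∧ Differentiable ℝ (deriv v) ∧ Differentiable ℝ (deriv (deriv v)) := by
  have h3 : ContDiff ℝ ((2 : WithTop ℕ∞) + 1) v := by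
    have e : ((2 : WithTop ℕ∞) + 1) = 3 := by norm_num
    rw [e]; exact hv
  have hd2 : ContDiff ℝ 2 (deriv v) := (contDiff_succ_iff_deriv.1 h3).2.2
  have h2 : ContDiff ℝ ((1 : WithTop ℕ∞) + 1) (deriv v) := by
    simpa [one_add_one_eq_two] using hd2
  have hd1 : ContDiff ℝ 1 (deriv (deriv v)) := (contDiff_succ_iff_deriv.1 h2).2.2
  exact ⟨hv.differentiable (by norm_num), hd2.differentiable (by norm_num), hd1.differentiable (by norm_num)⟩

/-- `V ∈ C³ ⇒ vort k V` is differentiable. -/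
theorem differentiable_vort {v : ℝ → ℝ} (hv : ContDiff ℝ 3 v) (k : ℝ) : Differentiable ℝ (vort k v) := by
  obtain ⟨h1, -, h3⟩ := diff_pack hv
  have : Differentiable ℝ (fun z => (deriv (deriv v) z - k ^ 2 * v z) / k) :=
    (h3.sub (h1.const_mul _)).div_const k
  exact this

/-- Derivative of `x ↦ cosh(k(c−x))`. -/
theorem hasDerivAt_cosh_lin (k c s : ℝ) :
    HasDerivAt (fun x => Real.cosh (k * (c - x))) (-k * Real.sinh (k * (c - s))) s := by
  have h1 : HasDerivAt (fun x => k * (c - x)) (k * (0 - 1)) s :=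
    ((hasDerivAt_const s c).sub (hasDerivAt_id s)).const_mul k
  have h2 : HasDerivAt (fun x => Real.cosh (k * (c - x))) (Real.sinh (k * (c - s)) * (k * (0 - 1))) s := h1.cosh
  have e : Real.sinh (k * (c - s)) * (k * (0 - 1)) = -k * Real.sinh (k * (c - s)) := by ring
  rw [e] at h2; exact h2

/-- Derivative of `x ↦ sinh(k(c−x))`. -/
theorem hasDerivAt_sinh_lin (k c s : ℝ) :
    HasDerivAt (fun x => Real.sinh (k * (c - x))) (-k * Real.cosh (k * (c - s))) s := by
  have h1 : HasDerivAt (fun x => k * (c - x)) (k * (0 - 1)) s :=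
    ((hasDerivAt_const s c).sub (hasDerivAt_id s)).const_mul k
  have h2 : HasDerivAt (fun x => Real.sinh (k * (c - x))) (Real.cosh (k * (c - s)) * (k * (0 - 1))) s := h1.sinh
  have e : Real.cosh (k * (c - s)) * (k * (0 - 1)) = -k * Real.cosh (k * (c - s)) := by ring
  rw [e] at h2; exact h2

/-- Derivative of `x ↦ sinh(kx)`. -/
theorem hasDerivAt_sinh_mul (k s : ℝ) :
    HasDerivAt (fun x => Real.sinh (k * x)) (k * Real.cosh (k * s)) s := by
  have h1 : HasDerivAt (fun x => k * x) (k * 1) s := (hasDerivAt_id s).const_mul k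
  have h2 : HasDerivAt (fun x => Real.sinh (k * x)) (Real.cosh (k * s) * (k * 1)) s := h1.sinh
  have e : Real.cosh (k * s) * (k * 1) = k * Real.cosh (k * s) := by ring
  rw [e] at h2; exact h2

/-- Derivative of `x ↦ cosh(kx)`. -/
theorem hasDerivAt_cosh_mul (k s : ℝ) :
    HasDerivAt (fun x => Real.cosh (k * x)) (k * Real.sinh (k * s)) s := by
  have h1 : HasDerivAt (fun x => k * x) (k * 1) s := (hasDerivAt_id s).const_mul k
  have h2 : HasDerivAt (fun x => Real.cosh (k * x)) (Real.sinh (k * s) * (k * 1)) s := h1.cosh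
  have e : Real.sinh (k * s) * (k * 1) = k * Real.sinh (k * s) := by ring
  rw [e] at h2; exact h2

/-- Green's identity on `[a, b]`: `∫ ψ (r'' − k²r) = [ψ r' − ψ' r]_a^b + ∫ r (ψ'' − k²ψ)`. -/
theorem green {ψ ψ' ψ'' r r' r'' : ℝ → ℝ} {a b : ℝ} (k : ℝ)
    (hψ : ∀ x, HasDerivAt ψ (ψ' x) x) (hψ' : ∀ x, HasDerivAt ψ' (ψ'' x) x)
    (hr : ∀ x, HasDerivAt r (r' x) x) (hr' : ∀ x, HasDerivAt r' (r'' x) x)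
    (cψ'' : Continuous ψ'') (cr'' : Continuous r'') :
    ∫ x in a..b, ψ x * (r'' x - k ^ 2 * r x)
      = (ψ b * r' b - ψ' b * r b) - (ψ a * r' a - ψ' a * r a) + ∫ x in a..b, r x * (ψ'' x - k ^ 2 * ψ x) := by
  have cψ : Continuous ψ := continuous_iff_continuousAt.2 fun x => (hψ x).continuousAt
  have cψ' : Continuous ψ' := continuous_iff_continuousAt.2 fun x => (hψ' x).continuousAt
  have cr : Continuous r := continuous_iff_continuousAt.2 fun x => (hr x).continuousAt
  have cr' : Continuous r' := continuous_iff_continuousAt.2 fun x => (hr' x).continuousAt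
  have i1 := intervalIntegral.integral_mul_deriv_eq_deriv_mul (a := a) (b := b)
    (fun x _ => hψ x) (fun x _ => hr' x) (cψ'.intervalIntegrable _ _) (cr''.intervalIntegrable _ _)
  have i2 := intervalIntegral.integral_mul_deriv_eq_deriv_mul (a := a) (b := b)
    (fun x _ => hψ' x) (fun x _ => hr x) (cψ''.intervalIntegrable _ _) (cr'.intervalIntegrable _ _)
  have I1 : IntervalIntegrable (fun x => ψ x * r'' x) volume a b := (cψ.mul cr'').intervalIntegrable _ _
  have I2 : IntervalIntegrable (fun x => k ^ 2 * (ψ x * r x)) volume a b :=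
    (continuous_const.mul (cψ.mul cr)).intervalIntegrable _ _
  have I3 : IntervalIntegrable (fun x => r x * ψ'' x) volume a b := (cr.mul cψ'').intervalIntegrable _ _
  have I4 : IntervalIntegrable (fun x => k ^ 2 * (r x * ψ x)) volume a b :=
    (continuous_const.mul (cr.mul cψ)).intervalIntegrable _ _
  have e1 : (fun x => ψ x * (r'' x - k ^ 2 * r x)) = fun x => ψ x * r'' x - k ^ 2 * (ψ x * r x) := by
    funext x; ring
  have e2 : (fun x => r x * (ψ'' x - k ^ 2 * ψ x)) = fun x => r x * ψ'' x - k ^ 2 * (r x * ψ x) := by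
    funext x; ring
  rw [e1, e2, intervalIntegral.integral_sub I1 I2, intervalIntegral.integral_sub I3 I4,
    intervalIntegral.integral_const_mul, intervalIntegral.integral_const_mul, i1]
  have e3 : (fun x => ψ' x * r' x) = fun x => ψ' x * r' x := rfl
  rw [i2]
  have e4 : (∫ x in a..b, ψ'' x * r x) = ∫ x in a..b, r x * ψ'' x := by
    congr 1; funext x; ring
  have e5 : (∫ x in a..b, ψ x * r x) = ∫ x in a..b, r x * ψ x := by
    congr 1; funext x; ring
  rw [e4, e5]; ring

/-- Derivative of `x ↦ e^{−cx}`. -/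
theorem hasDerivAt_exp_lin (c s : ℝ) :
    HasDerivAt (fun x => Real.exp (-c * x)) (-c * Real.exp (-c * s)) s := by
  have h1 : HasDerivAt (fun x => -c * x) (-c * 1) s := (hasDerivAt_id s).const_mul (-c)
  have h2 : HasDerivAt (fun x => Real.exp (-c * x)) (Real.exp (-c * s) * (-c * 1)) s := h1.exp
  have e : Real.exp (-c * s) * (-c * 1) = -c * Real.exp (-c * s) := by ring
  rw [e] at h2; exact h2

/-- Discriminant form of Cauchy–Schwarz: if `A − 2tB + t²C ≥ 0` for all `t` and `C ≥ 0` then `B² ≤ A·C`. -/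
theorem sq_le_of_quad_nonneg {A B C : ℝ} (hC : 0 ≤ C) (h : ∀ t : ℝ, 0 ≤ A - 2 * t * B + t ^ 2 * C) :
    B ^ 2 ≤ A * C := by
  rcases hC.eq_or_lt with hC0 | hCpos
  · -- C = 0: then B = 0
    subst hC0
    have hA : 0 ≤ A := by simpa using h 0
    by_contra hne
    have hB : B ≠ 0 := by
      intro hB; apply hne; subst hB; simp
    have := h ((A + 1) / (2 * B))
    have h2 : 2 * ((A + 1) / (2 * B)) * B = A + 1 := by field_simp
    rw [h2] at this
    linarith
  · have := h (B / C)
    have h2 : A - 2 * (B / C) * B + (B / C) ^ 2 * C = A - B ^ 2 / C := by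
      field_simp; ring
    rw [h2] at this
    have h3 : B ^ 2 / C ≤ A := by linarith
    rwa [div_le_iff₀ hCpos] at h3

/-- `L²` Cauchy–Schwarz for interval integrals of continuous functions on `[a, b]`, `a ≤ b`. -/
theorem integral_mul_sq_le {f g : ℝ → ℝ} {a b : ℝ} (hab : a ≤ b) (hf : Continuous f) (hg : Continuous g) :
    (∫ x in a..b, f x * g x) ^ 2 ≤ (∫ x in a..b, f x ^ 2) * (∫ x in a..b, g x ^ 2) := by
  apply sq_le_of_quad_nonneg
  · exact intervalIntegral.integral_nonneg hab (fun x _ => sq_nonneg (g x))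
  · intro t
    have hI1 : IntervalIntegrable (fun x => f x ^ 2) volume a b := (hf.pow 2).intervalIntegrable _ _
    have hI2 : IntervalIntegrable (fun x => f x * g x) volume a b := (hf.mul hg).intervalIntegrable _ _
    have hI3 : IntervalIntegrable (fun x => g x ^ 2) volume a b := (hg.pow 2).intervalIntegrable _ _
    have key : (∫ x in a..b, f x ^ 2) - 2 * t * (∫ x in a..b, f x * g x) + t ^ 2 * (∫ x in a..b, g x ^ 2)
        = ∫ x in a..b, (f x - t * g x) ^ 2 := by
      have : (fun x => (f x - t * g x) ^ 2) = fun x => f x ^ 2 - (2 * t) * (f x * g x) + t ^ 2 * g x ^ 2 := by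
        funext x; ring
      rw [this, intervalIntegral.integral_add (hI1.sub (hI2.const_mul _)) (hI3.const_mul _),
        intervalIntegral.integral_sub hI1 (hI2.const_mul _), intervalIntegral.integral_const_mul,
        intervalIntegral.integral_const_mul]
    rw [key]
    exact intervalIntegral.integral_nonneg hab (fun x _ => sq_nonneg _)

/-- `|∫ f g| ≤ √(∫ f²) √(∫ g²)`. -/
theorem abs_integral_mul_le {f g : ℝ → ℝ} {a b : ℝ} (hab : a ≤ b) (hf : Continuous f) (hg : Continuous g) :
    |∫ x in a..b, f x * g x| ≤ Real.sqrt (∫ x in a..b, f x ^ 2) * Real.sqrt (∫ x in a..b, g x ^ 2) := by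
  have h := integral_mul_sq_le hab hf hg
  have hA : 0 ≤ ∫ x in a..b, f x ^ 2 := intervalIntegral.integral_nonneg hab (fun x _ => sq_nonneg _)
  have hC : 0 ≤ ∫ x in a..b, g x ^ 2 := intervalIntegral.integral_nonneg hab (fun x _ => sq_nonneg _)
  rw [← Real.sqrt_mul hA, ← Real.sqrt_sq_eq_abs]
  exact Real.sqrt_le_sqrt h

/-- Integration by parts for the form `a(φ, Ω) = ∫ (αφ'Ω' + νφΩ)`:
`∫₀ᴸ (−αφ'' + νφ) Ω = a(φ, Ω) − α (φ'(L)Ω(L) − φ'(0)Ω(0))`. -/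
theorem ibp {φ φ' φ'' Ω Ω' : ℝ → ℝ} (α ν L : ℝ)
    (hφ : ∀ x, HasDerivAt φ (φ' x) x) (hφ' : ∀ x, HasDerivAt φ' (φ'' x) x)
    (hΩ : ∀ x, HasDerivAt Ω (Ω' x) x) (cφ'' : Continuous φ'') (cΩ' : Continuous Ω') :
    ∫ x in (0:ℝ)..L, (-α * φ'' x + ν * φ x) * Ω x
      = (∫ x in (0:ℝ)..L, (α * (φ' x * Ω' x) + ν * (φ x * Ω x))) - α * (φ' L * Ω L - φ' 0 * Ω 0) := by
  have cφ : Continuous φ := continuous_iff_continuousAt.2 fun x => (hφ x).continuousAt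
  have cφ' : Continuous φ' := continuous_iff_continuousAt.2 fun x => (hφ' x).continuousAt
  have cΩ : Continuous Ω := continuous_iff_continuousAt.2 fun x => (hΩ x).continuousAt
  have i1 := intervalIntegral.integral_mul_deriv_eq_deriv_mul (a := (0:ℝ)) (b := L)
    (fun x _ => hφ' x) (fun x _ => hΩ x) (cφ''.intervalIntegrable _ _) (cΩ'.intervalIntegrable _ _)
  -- i1 : ∫ φ' Ω' = φ' L Ω L − φ' 0 Ω 0 − ∫ φ'' Ω
  have I1 : IntervalIntegrable (fun x => -α * (φ'' x * Ω x)) volume 0 L :=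
    (continuous_const.mul (cφ''.mul cΩ)).intervalIntegrable _ _
  have I2 : IntervalIntegrable (fun x => ν * (φ x * Ω x)) volume 0 L :=
    (continuous_const.mul (cφ.mul cΩ)).intervalIntegrable _ _
  have I3 : IntervalIntegrable (fun x => α * (φ' x * Ω' x)) volume 0 L :=
    (continuous_const.mul (cφ'.mul cΩ')).intervalIntegrable _ _
  have e1 : (fun x => (-α * φ'' x + ν * φ x) * Ω x) = fun x => -α * (φ'' x * Ω x) + ν * (φ x * Ω x) := by
    funext x; ring
  rw [e1, intervalIntegral.integral_add I1 I2, intervalIntegral.integral_add I3 I2,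
    intervalIntegral.integral_const_mul, intervalIntegral.integral_const_mul, intervalIntegral.integral_const_mul, i1]
  ring

/-- Weighted Cauchy–Schwarz for the form `a`: `a(φ, Ω)² ≤ a(φ)·a(Ω)`. -/
theorem wcs {p q r t : ℝ → ℝ} {α ν L : ℝ} (hα : 0 ≤ α) (hν : 0 ≤ ν) (hL : 0 ≤ L)
    (cp : Continuous p) (cq : Continuous q) (cr : Continuous r) (ct : Continuous t) :
    (∫ x in (0:ℝ)..L, (α * (p x * r x) + ν * (q x * t x))) ^ 2
      ≤ (∫ x in (0:ℝ)..L, (α * p x ^ 2 + ν * q x ^ 2)) * (∫ x in (0:ℝ)..L, (α * r x ^ 2 + ν * t x ^ 2)) := by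
  apply sq_le_of_quad_nonneg
  · exact intervalIntegral.integral_nonneg hL (fun x _ => by positivity)
  · intro s
    have hI1 : IntervalIntegrable (fun x => α * p x ^ 2 + ν * q x ^ 2) volume 0 L := by
      apply Continuous.intervalIntegrable; fun_prop
    have hI2 : IntervalIntegrable (fun x => α * (p x * r x) + ν * (q x * t x)) volume 0 L := by
      apply Continuous.intervalIntegrable; fun_prop
    have hI3 : IntervalIntegrable (fun x => α * r x ^ 2 + ν * t x ^ 2) volume 0 L := by
      apply Continuous.intervalIntegrable; fun_prop
    have key : (∫ x in (0:ℝ)..L, (α * p x ^ 2 + ν * q x ^ 2)) - 2 * s * (∫ x in (0:ℝ)..L, (α * (p x * r x) + ν * (q x * t x)))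
        + s ^ 2 * (∫ x in (0:ℝ)..L, (α * r x ^ 2 + ν * t x ^ 2))
        = ∫ x in (0:ℝ)..L, (α * (p x - s * r x) ^ 2 + ν * (q x - s * t x) ^ 2) := by
      have : (fun x => α * (p x - s * r x) ^ 2 + ν * (q x - s * t x) ^ 2)
          = fun x => (α * p x ^ 2 + ν * q x ^ 2) - (2 * s) * (α * (p x * r x) + ν * (q x * t x))
            + s ^ 2 * (α * r x ^ 2 + ν * t x ^ 2) := by
        funext x; ring
      rw [this, intervalIntegral.integral_add (hI1.sub (hI2.const_mul _)) (hI3.const_mul _),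
        intervalIntegral.integral_sub hI1 (hI2.const_mul _), intervalIntegral.integral_const_mul,
        intervalIntegral.integral_const_mul]
    rw [key]
    exact intervalIntegral.integral_nonneg hL (fun x _ => by positivity)


end Summit.NavierStokesRegularity.TurbBounds.FSU1.Mode
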